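import Summits.BirchSwinnertonDyer.BirchSwinnertonDyer.Theorems.PrintX10bUpperLinkRoad
import Summits.BirchSwinnertonDyer.BirchSwinnertonDyer.Theorems.PrintX10bBeyondCarrierUpperLinkOfPrint
import Summits.BirchSwinnertonDyer.BirchSwinnertonDyer.Theorems.PrintX9HeegnerDivisibility
import Summits.BirchSwinnertonDyer.BirchSwinnertonDyer.Theorems.KolyvaginRoadThreeTowerFormPrintFree
import Literature.NumberTheory.EllipticCurves.BSDSelmerCMPConverseHeegnerFieldProofs
import Summits.BirchSwinnertonDyer.BirchSwinnertonDyer.Theses.PrintX10b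
import HarnessLib

/-!
# `cha-sandwich-mu-x10b` — K2 support lemma, TYPED: residual invariance of the μ-part of `X_ac` (BDP currency)

Seat bsd-idea-5 g7 (D-0145 ideator, lens «transfer»). PUBLISH-ONLY (W-79): statement file, not registered, no
`skeleton check`; no `sorry`; nothing asserted — `ResidualMuInvarianceBDP` is a `Prop` to be PROVED by a prover
(routine Galois cohomology, memo DESKCHECK §12), after which the K2 step of `stub_upperLink_carrier…` of
`Lines/cha_sandwich_mu_x10b.lean` is no longer a crux. BSD is not proved by any of this.

STATEMENT (memo §12.1). `K` imaginary quadratic, `p = 𝔭𝔭̄` split, `K_∞` anticyclotomic, `E₁, E₂ /ℚ` with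
`E₁[p] ≅ E₂[p]` as `G_K`-modules, `ρ̄|G_K` irreducible, every prime of `N₁ N₂` split in `K` (joint Heegner).
Then `X_ac(E₁)` is finitely generated over `ℤ_p` iff `X_ac(E₂)` is — typed as finiteness of `X/pX` (Nakayama),
`X_ac = X11b.AcSelmer.XAc (E_K) p κ 𝔭 ∅ γ` the tree's Λ-dual of Castella's `Sel_𝔭(K_∞, E[p^∞])`.
PROOF SKETCH (§12.2): `H⁰(K_∞, E[p^∞]) = 0` ((irr_K), `Γ⁻` pro-`p`); `Sel_𝔭^∅ = ` classes in `H¹(K_{Σp}/K_∞)`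
strict at `Σ_{K_∞} ∪ {w ∣ 𝔭}` (unramified classes at `w ∉ Σ` are locally trivial over `K_∞`); the residual group
`Sel(ρ̄)` (same conditions on `E[p]`) is common to `E₁, E₂` and has finite index in `Sel_𝔭^∅(E_i)[p]`, the
cokernel living on the FINITELY many `w ∈ Σ_{K_∞} ∪ {w ∣ 𝔭}` (split primes are finitely decomposed), each term
`E_i(K_{∞,w})[p^∞] ⊗ ℤ/p` finite. No (H0) at `p`, no (TR), no `p ∤ h_K`, no ordinarity are used (contrast
Lei–Lim–Müller arXiv:2302.06553 Thm 1, whose (H0)/(TR)/`p ∤ h_K` serve exact control and the λ-formula).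
-/

set_option autoImplicit false
set_option linter.dupNamespace false

noncomputable section

open scoped Classical MatrixGroups ModularForm

open CongruenceSubgroup WeierstrassCurve NumberField IsDedekindDomain
  Literature.NumberTheory.EllipticCurves Literature.NumberTheory.EllipticCurves.ModularForms
  Literature.NumberTheory.EllipticCurves.JetchevSkinnerWan2017
  Literature.NumberTheory.EllipticCurves.YanZhu2026
  Summit.BirchSwinnertonDyer.BirchSwinnertonDyer.Theorems.Rank1ResidualX1Defs
  Summit.BirchSwinnertonDyer.Rank1Residual
  Summit.BirchSwinnertonDyer.Rank1Residual.X11b.Three.Koly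
  Summit.BirchSwinnertonDyer.Rank1Residual.X11b.KolyvaginBottom
  Summit.BirchSwinnertonDyer.BirchSwinnertonDyer.Rank1Residual
  Summit.BirchSwinnertonDyer.BirchSwinnertonDyer.Theses.PrintX10b

open Literature.NumberTheory.EllipticCurves.Rank1Residual (ClassX10 Surj Irr Good GoodOrd)

namespace Summit.BirchSwinnertonDyer.BirchSwinnertonDyer.Cruxes.HowardContainmentAnyClassNumberX10b.ChaSandwichMuX10b

/-- **(FG) typed**: "`X_ac^∅(E[p^∞])` is finitely generated over `ℤ_p`", as finiteness of `X ⧸ pX`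
(equivalent by Nakayama for the compact `Λ`-module `X`; it implies `X` is `Λ`-torsion with `μ = 0`). [folklore] -/
def XAcModPFinite {K : Type} [Field K] [NumberField K] (W : WeierstrassCurve K) (p : ℕ) [Fact p.Prime]
    (κ : ZpExtension K p) (𝔭 : HeightOneSpectrum (𝓞 K)) (γ : Field.absoluteGaloisGroup K)
    [Fact (κ.IsTopGenerator γ)] : Prop :=
  Finite (X11b.AcSelmer.XAc W p κ 𝔭 ∅ γ ⧸
    ((Ideal.span {(p : IwasawaAlgebra p)}) •
      (⊤ : Submodule (IwasawaAlgebra p) (X11b.AcSelmer.XAc W p κ 𝔭 ∅ γ))))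

/-- **Mod-`p` congruence over a field `F`**: a `Γ_F`-equivariant isomorphism `E₁[p] ≅ E₂[p]` of the geometric
`p`-torsion (`geomTorsion`, Silverman AEC III.§7). [folklore] -/
def ModPCongruentOver {F : Type} [Field F] (W₁ W₂ : WeierstrassCurve F) (p : ℕ) : Prop :=
  ∃ e : W₁.geomTorsion p ≃+ W₂.geomTorsion p,
    ∀ (σ : Field.absoluteGaloisGroup F) (P : W₁.geomTorsion p), e (σ • P) = σ • e P

/-- **K2 support lemma — `ResidualMuInvarianceBDP`** (memo §12.1; to be proved, routine): on a JOINT HEEGNER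
frame the property "`X_ac` is finitely generated over `ℤ_p`" is an invariant of the residual representation
`ρ̄|G_K`. Binders follow the route's light-frame conventions (`UpperLinkLightX10bOn`): `𝔭 = inducedPlace ι`.
[cite: GreenbergVatsal2000, Prop. 2.8 (the cyclotomic model of the argument)] [cite: arXiv:2302.06553, Thm 1
(finer λ-statement under (H0), (TR), p ∤ h_K)] -/
def ResidualMuInvarianceBDP : Prop :=
  ∀ (W₁ W₂ : WeierstrassCurve ℚ) [W₁.IsElliptic] [W₂.IsElliptic] [W₁.IsGloballyMinimal]
    [W₂.IsGloballyMinimal] [NeZero (W₁.conductorNorm ℤ)] [NeZero (W₂.conductorNorm ℤ)]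
    (p : ℕ) [Fact p.Prime] (K : Type) [Field K] [NumberField K],
    IsImaginaryQuadratic K →
    SatisfiesHeegnerHypothesis (W₁.conductorNorm ℤ) K → SatisfiesHeegnerHypothesis (W₂.conductorNorm ℤ) K →
    SatisfiesHeegnerHypothesis p K → (W₁.baseChange K).HasIrreducibleModPGaloisRep p →
    ModPCongruentOver (W₁.baseChange K) (W₂.baseChange K) p →
    ∀ (ι : K →+* ℚ_[p]) (κ : ZpExtension K p), κ.IsAnticyclotomic →
    ∀ (γ : Field.absoluteGaloisGroup K) [Fact (κ.IsTopGenerator γ)],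
      (XAcModPFinite (W₁.baseChange K) p κ (X11b.inducedPlace ι) γ ↔
        XAcModPFinite (W₂.baseChange K) p κ (X11b.inducedPlace ι) γ)

/-- Sanity: congruence is symmetric (so the lemma may be applied from either partner). [folklore] -/
theorem ModPCongruentOver.symm {F : Type} [Field F] {W₁ W₂ : WeierstrassCurve F} {p : ℕ}
    (h : ModPCongruentOver W₁ W₂ p) : ModPCongruentOver W₂ W₁ p := by
  obtain ⟨e, he⟩ := h
  refine ⟨e.symm, fun σ Q ↦ ?_⟩
  apply e.injective
  rw [he, AddEquiv.apply_symm_apply, AddEquiv.apply_symm_apply]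

/-- Sanity: the lemma is symmetric in the two curves (trivial from the `↔`). [folklore] -/
theorem residualMuInvarianceBDP_useDirection (h : ResidualMuInvarianceBDP)
    (W₁ W₂ : WeierstrassCurve ℚ) [W₁.IsElliptic] [W₂.IsElliptic] [W₁.IsGloballyMinimal]
    [W₂.IsGloballyMinimal] [NeZero (W₁.conductorNorm ℤ)] [NeZero (W₂.conductorNorm ℤ)]
    (p : ℕ) [Fact p.Prime] (K : Type) [Field K] [NumberField K]
    (hK : IsImaginaryQuadratic K) (hH₁ : SatisfiesHeegnerHypothesis (W₁.conductorNorm ℤ) K)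
    (hH₂ : SatisfiesHeegnerHypothesis (W₂.conductorNorm ℤ) K) (hp : SatisfiesHeegnerHypothesis p K)
    (hirr : (W₁.baseChange K).HasIrreducibleModPGaloisRep p)
    (hc : ModPCongruentOver (W₁.baseChange K) (W₂.baseChange K) p)
    (ι : K →+* ℚ_[p]) (κ : ZpExtension K p) (hκ : κ.IsAnticyclotomic)
    (γ : Field.absoluteGaloisGroup K) [Fact (κ.IsTopGenerator γ)]
    (hA : XAcModPFinite (W₂.baseChange K) p κ (X11b.inducedPlace ι) γ) :
    XAcModPFinite (W₁.baseChange K) p κ (X11b.inducedPlace ι) γ :=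
  (h W₁ W₂ p K hK hH₁ hH₂ hp hirr hc ι κ hκ γ).mpr hA

end Summit.BirchSwinnertonDyer.BirchSwinnertonDyer.Cruxes.HowardContainmentAnyClassNumberX10b.ChaSandwichMuX10b
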